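import Summits.ABC.IUTFork.Joshi.Holomorphoids
import Summits.ABC.IUTFork.Joshi.MochizukiAnsatzLocal
import HarnessLib

/-!
# Merge-debt M-4 in kernel: the LOCAL holomorphoid of [J-IIp] Def. 3.2.1 (`Joshi.Holomorphoid`, one place, one tilt, WITH the
# anabelomorphism label) ↦ the local holomorphoid `hol(X/L)_{y_v}` of [J-III] Def. 2.1.5 (5) (`ATS3.LocalHolomorphoid`), along a seam

Object-side bridge file of the abc-iut cell, branch E (rung LADDER-ABC:A2.E; seat abc-iut-E-t2; plan/E/ASSIGNMENTS.md §3 merge-debt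
M-4, recorded in abc-iut-E-t5's `Joshi/Holomorphoids.lean` (p431320) docstring: «E-t2's LOCAL `Joshi.Holomorphoid X D` … is the
one-place, one-tilt specialisation of `LocalHolomorphoid` (no map typed: it needs the period-ring datum)» — the map is typed HERE,
over an explicit SEAM datum). No OUR-side import (E-PLAN R14). TAKES NO SIDE on [IUTchIII] Cor. 3.12 or on any author; typed ≠
proved ≠ endorsed; sources K. Joshi arXiv:2303.01662v3 [J-IIp] (bib `Joshi2023ATS2Local`) and arXiv:2401.13508v4 [J-III] (bib
`Joshi2024ATS3`), unrefereed.

THE TWO TYPINGS. `Joshi.Holomorphoid X D` ([J-IIp] Def. 3.2.1 p. 9 l. 30–35, my `Joshi/MochizukiAnsatzLocal`, p429331) = abc-iut-E-t1's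
`ATSObj X` — the triple `(Y/E′, E′ ↪ K, α : Π^temp(Y/E′) ≅ Π^temp(X/E))`, an object of the LOCAL Arithmetic Teichmüller space `𝔍(X,E)`
of [J-I] — together with a base point and the closed classical point `y` of abc-iut-E-t3's carrier (`PeriodRingDatum.Y`) whose residue
field IS the untilt (`K y ≃+* U.K`). `ATS3.LocalHolomorphoid G v` ([J-III] Def. 2.1.5 (5) p. 22 l. 1–6; Lemma 2.1.6's rule p. 22
l. 14–26, abc-iut-E-t5) = a point `y_v ∈ |Y_v|` of the abstract adelic signature `ArithFFDatum`, a scheme `X` of an abstract category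
`Sch`, and the geometric base point as a morphism `M(K_{y_v}) ⟶ X^an_{L_v}` of an abstract category `An v` — WITHOUT any anabelomorphism
label: [J-III] Rmk. 2.1.4 (1) p. 20 l. 26–30 «each local holomorphoid … gives a point … of the local Arithmetic Teichmüller Space
`J(X,L_v)` … But the category `J(X,L_v)` considered in [Joshi, 2021a] is bigger than the category of holomorphoids considered here».
So the honest map goes FROM the [J-IIp]/[J-I] object (more data) TO the [J-III] one (less data), along a SEAM saying how the one-place
carriers sit inside the adelic signature at the place `v`: `LocalGlobalSeam` (§1). The converse direction (Lemma 2.1.6: `Y := X`,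
`α := id`) is E-t5 ↔ E-t1's merge-debt M-2 and is not typed here.

CONTENTS: `LocalGlobalSeam` (DATA: point map, object map forgetting `α` and the untilt, base-point map); `Holomorphoid.toLocal` and its
component lemmas; on MOCHIZUKI'S ANSATZ `Σ_{𝔍(X,E)}` ([J-IIp] Def. 6.11.1, `mochizukiAnsatz`): the tuple of [J-III]-local holomorphoids
`ansatzToLocal`, whose point tuple is the seam image of a Primitive-Ansatz tuple (`ansatzToLocal_points`) — the form in which [J-III]
§4 (Adelic Ansatz, abc-iut-E-t7) sees a [J-IIp] Ansatz object at one place. Kernel bookkeeping only; nothing asserted.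
[claim: Joshi2023ATS2Local, status: disputed] [claim: Joshi2024ATS3, status: disputed]
-/

noncomputable section

universe u u₁ v₁ u₂ v₂

namespace Summit.ABC.IUTFork.Joshi

open CategoryTheory
open Literature.AnabelianGeometry.SemiGraphs (TemperedCurve)

variable {F B E0 : Type} [Field F] [CommRing B] [Field E0] {Y : Type} {K : Y → Type} [∀ y, Field (K y)] {G₀ : Type}
  {p : ℕ} [Fact p.Prime]
  {L : Type u} [Field L] {A : ATS3.ArithFFDatum L} {Sch : Type u₁} [Category.{v₁} Sch]
  {An : A.V → Type u₂} [∀ v, Category.{v₂} (An v)]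

/-! ## 1. The seam -/

/-- **The M-4 SEAM at a place `v`** — how the one-place carriers of [J-IIp] (abc-iut-E-t3's degree-one points `Y` of `𝒴_{F,ℚ_p}`,
abc-iut-E-t1's objects of `𝔍(X,E)`) sit inside abc-iut-E-t5's adelic signature ([J-III] §2.1; [J2h] Def. 4.1.1 `𝒴_L = ∏_v |Y_v|`):
a map of points `|𝒴_{F,ℚ_p}| → |Y_v|` (the same Fargues–Fontaine curve at the place `v | p`, two carriers), a map of objects
FORGETTING the anabelomorphism label `α` and the untilt (the curve `Y/E′` as an object of `Sch`; [J-III] Rmk. 2.1.4 (1) «the category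
`J(X,L_v)` … is bigger»), and the geometric base point of each local holomorphoid as a morphism `M(K_{y_v}) ⟶ X^an_{L_v}` ([J-III]
(2.1.3); my carrier keeps the base point abstract). DATA ONLY; nothing asserted. [claim: Joshi2024ATS3, status: disputed]
[claim: Joshi2023ATS2Local, status: disputed] -/
structure LocalGlobalSeam (X : TemperedCurve p) (D : PeriodRingDatum F B E0 Y K G₀) (G : ATS3.AnalyticSignature A Sch An)
    (v : A.V) where
  /-- `|𝒴_{F,ℚ_p}| → |Y_{L̂̄_v^♭, L_v}|` on closed classical points -/
  ptMap : Y → A.Y v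
  /-- `(Y/E′, E′ ↪ K, α) ↦ Y` as an object of `Sch` (forget `α` and the untilt) -/
  objMap : ATSObj X → Sch
  /-- the geometric base point of a local holomorphoid, as the morphism `M(K_{y_v}) ⟶ X^an_{L_v}` of (2.1.3) -/
  baseMap : ∀ H : Holomorphoid X D, G.spectrum v (ptMap H.pt) ⟶ (G.an v).obj (objMap H.toATS)

/-! ## 2. The map: [J-IIp] local holomorphoid ↦ [J-III] local holomorphoid at `v` -/

namespace Holomorphoid

variable {X : TemperedCurve p} {D : PeriodRingDatum F B E0 Y K G₀} {G : ATS3.AnalyticSignature A Sch An} {v : A.V}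

/-- **M-4, the map**: along a seam, a [J-IIp] holomorphoid `(Y/E′, E′ ↪ K_y, α, ∗, y)` IS a [J-III] local holomorphoid
`hol(X/L)_{y_v} = (y_v, X, M(K_{y_v}) → X^an_{L_v})` at `v` (Lemma 2.1.6's rule, p. 22 l. 14–26, read at one place; the label `α` is
forgotten — Rmk. 2.1.4 (1)). [claim: Joshi2024ATS3, status: disputed] [claim: Joshi2023ATS2Local, status: disputed] -/
def toLocal (σ : LocalGlobalSeam X D G v) (H : Holomorphoid X D) : ATS3.LocalHolomorphoid G v :=
  ⟨σ.ptMap H.pt, σ.objMap H.toATS, σ.baseMap H⟩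

/-- The [J-III] point of the image is the seam image of the [J-IIp] point. [folklore] -/
theorem toLocal_y (σ : LocalGlobalSeam X D G v) (H : Holomorphoid X D) : (H.toLocal σ).y = σ.ptMap H.pt := rfl

/-- … equivalently for E-t5's `LocalHolomorphoid.point` (Rmk. 2.1.9's projection `{hol(X/L)_{y_v}} → y_v`). [folklore] -/
theorem toLocal_point (σ : LocalGlobalSeam X D G v) (H : Holomorphoid X D) : (H.toLocal σ).point = σ.ptMap H.pt := rfl

/-- The scheme of the image is the underlying curve of the `𝔍(X,E)`-object, label forgotten. [folklore] -/
theorem toLocal_X (σ : LocalGlobalSeam X D G v) (H : Holomorphoid X D) : (H.toLocal σ).X = σ.objMap H.toATS := rfl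

/-- The base point of the image is the seam's rendering of the [J-IIp] base point as a morphism of `An v`. [folklore] -/
theorem toLocal_basePoint (σ : LocalGlobalSeam X D G v) (H : Holomorphoid X D) : (H.toLocal σ).basePoint = σ.baseMap H := rfl

/-- Two [J-IIp] holomorphoids over the SAME point `y` land over the same [J-III] point `y_v` — the map factors through
Rmk. 2.1.9's projection. [folklore] -/
theorem toLocal_y_eq_of_pt_eq (σ : LocalGlobalSeam X D G v) {H H' : Holomorphoid X D} (h : H.pt = H'.pt) :
    (H.toLocal σ).y = (H'.toLocal σ).y := by
  rw [toLocal_y, toLocal_y, h]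

end Holomorphoid

/-! ## 3. On Mochizuki's Ansatz (Def. 6.11.1): the tuple of [J-III]-local holomorphoids of an Ansatz object -/

section Ansatz

variable {X : TemperedCurve p} {P : PrototypeDatum F B E0 Y K G₀} {G : ATS3.AnalyticSignature A Sch An} {v : A.V}

/-- The `ℓ⋆`-tuple of [J-III] local holomorphoids at `v` of a tuple of [J-IIp] holomorphoids (in particular of an object of
MOCHIZUKI'S ANSATZ `Σ_{𝔍(X,E)}`, [J-IIp] Def. 6.11.1 p. 19 l. 7–29 — the shape in which [J-III] §4's Adelic Ansatz (abc-iut-E-t7's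
`AdelicAnsatz`) sees it at one place). [claim: Joshi2023ATS2Local, status: disputed] [claim: Joshi2024ATS3, status: disputed] -/
def ansatzToLocal (σ : LocalGlobalSeam X P.toPeriodRingDatum G v) (Aobj : Fin P.lstar → Holomorphoid X P.toPeriodRingDatum) :
    Fin P.lstar → ATS3.LocalHolomorphoid G v :=
  fun i => (Aobj i).toLocal σ

/-- The point tuple of the image is the seam image of the [J-IIp] point tuple (`Holomorphoid.pts`). [folklore] -/
theorem ansatzToLocal_y (σ : LocalGlobalSeam X P.toPeriodRingDatum G v) (Aobj : Fin P.lstar → Holomorphoid X P.toPeriodRingDatum)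
    (i : Fin P.lstar) : (ansatzToLocal σ Aobj i).y = σ.ptMap (Holomorphoid.pts Aobj i) := rfl

/-- **For an object of Mochizuki's Ansatz the [J-III] point tuple at `v` is the seam image of a PRIMITIVE-ANSATZ tuple**
`(y_1(a), …, y_{ℓ⋆}(a))` ([J-IIp] Def. 6.2.3 / 6.11.1; abc-iut-E-t3's `ansatzPt`). DERIVED. [claim: Joshi2023ATS2Local, status: disputed] -/
theorem ansatzToLocal_points (σ : LocalGlobalSeam X P.toPeriodRingDatum G v)
    {Aobj : Fin P.lstar → Holomorphoid X P.toPeriodRingDatum} (hA : Aobj ∈ mochizukiAnsatz X P) :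
    ∃ a ∈ P.AnsatzParam, (fun i => (ansatzToLocal σ Aobj i).y) = fun i => σ.ptMap (P.ansatzPt a i) := by
  obtain ⟨a, ha, hpts⟩ := hA
  refine ⟨a, ha, funext fun i => ?_⟩
  rw [ansatzToLocal_y, hpts]

end Ansatz

end Summit.ABC.IUTFork.Joshi

end
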